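/-
Copyright (c) 2026 the pub-hodgecm-mathlib formalisation cell (harness21).  Prover seat hodgecm-mathlib-K2Liu-p02 (g4), Track B «K2-LIT» ∕
hLiu418 #184♮, socket #42N «MODEL IDENTIFICATION» of the #42R road, FILE (P2b, group ∕ symplectic side) of road (N″) «by the see-saw permutation»
(LEAD F0P6-plan (g11) rulings «M-155k» (9), «M-155m» (2)), 2026-09-04.
-/
import Summits.HodgeConjecture.HodgeConjecture.Theorems.K2LiuUndoublingSeesawPermutationMem
import Literature.NumberTheory.Weil1964.AdelicMetaplecticLeviPermutation

/-!
# Crux `HLiu418`, road `K2_Liu`, socket #42N — FILE (P2b): the see-saw permutation in the SYMPLECTIC group is Weil's rational Levi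
# permutation, and every lift of it acts on `𝒮(𝔸^{n+n})` by the coordinate permutation up to a central scalar

Cell `hodgecm-mathlib`, crux item hLiu418 = `stmt-HodgeConjecture-24832`; squad K2 ∕ K2Liu, prover K2Liu-p02 (g4), steward lineage of socket #42R.
THEOREMS ONLY (no `def` ∕ instance ∕ notation ∕ named-fact hypothesis ∕ `sorry`); lane `--supports stmt-HodgeConjecture-24832 --as helper`
(count-neutral).  Sequel of ★ `K2LiuUndoublingSeesawPermutation` (P1) ∕ ★ `K2LiuUndoublingSeesawPermutationMem` (P2); Weil side ★
`Weil1964.AdelicMetaplecticLeviPermutation` (K2E2-p12 (g3), p857504).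

* §1 coordinates: `ρ⁻¹ ∘ σ⁻¹ = e₂ ∘ (r ⊕ r)` (`seesawPerm_symm_idxSplitD_symm`), the RE-LABELLING of pure tensors
  `R_ρ (Ψ₁ ⊠_{ρ ≫ e} Ψ₂) = Ψ₁ ⊠_e Ψ₂` (`piSBReindex_sumTensor_trans`) and the SHUFFLE
  `Ψ₁ ⊠_{ρ ≫ σ} Ψ₂ = R_{e₂} (R_r Ψ₁ ⊠ R_r Ψ₂)` (`sumTensor_seesawPerm_trans_idxSplitD`), `σ = idxSplitD e₁ e₀ e₀`, `r = rowEquiv e₁`;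
* §2 matrices: `T^𝔻_𝔸.submatrix ρ ρ = T^𝔻_𝔸`, so the permutation matrix COMMUTES with `T^𝔻_𝔸` and `T⁻¹ ᵗP⁻¹ T = P`; its real ∕ imaginary parts
  in the CM coordinates `L = L⁺ ⊕ L⁺δ` are `P` and `0`;
* §3 **`ι^𝔻(δ′) = ratSp (m(P))`** (`toSpD_permGL_seesawPerm`): the symplectic image of the rational unitary point `δ′ = permGL ρ ∈ H(V)(L⁺)` is the
  adelic image of Weil's rational LEVI element `m(P)`, `P = permGL ρ ∈ GL_{n+n}(L⁺)` (★ `adelicToSymplectic_toAdelic_apply` vs ★ `ratSp_levi`);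
* §4 **every lift acts by `R_ρ` up to a scalar** (`exists_omega_eq_smul_piSBReindex`): for `sD` over `ι^𝔻` (`proj_eq`), `ω(sD δ′) Ψ = c • R_ρ Ψ` with
  `c ≠ 0` — `sD δ′ = r_F(m(P)) · (1, c)` by exactness of `1 → ℂˣ → Mp → Sp` (★ `adelicMpCont.exists_eq_ofScalar_of_proj_eq_one`) and
  `ω(r_F(m(P))) = R_ρ` with character factor `1` (★ `coe_omega_ratThetaLiftCont_levi_perm`).  On road (N″) the scalar `c` CANCELS (conjugation).

HONEST LABEL.  Count-neutral helper; it pays nothing by itself: `HC_CM` is proved only modulo the 7 printed citations (2 remaining named inputs: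
hLiu418 = `stmt-HodgeConjecture-24832`, h413 = `stmt-HodgeConjecture-24833`) until rung 0 closes.
References: [Weil1964] Chap. I n° 13, Chap. III n° 37–41; [Kudla1994] §2 (doubled space, Siegel parabolic); [Kudla1984] §1; [GelbartRogawski1991] §3.1
p. 454–455; [MoeglinVignerasWaldspurger1987] Chap. 2 II.1.
-/

set_option autoImplicit false
-- the mandated namespace repeats the single-problem summit's segment (`HodgeConjecture.HodgeConjecture`)
set_option linter.dupNamespace false

noncomputable section

open scoped Classical Matrix Kronecker
open NumberField IsDedekindDomain
open Literature.NumberTheory.Automorphic hiding permGL coe_permGL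
open Literature.NumberTheory.GelbartRogawski1991.GRConstruction Literature.NumberTheory.GelbartRogawski1991.UnitaryDualPair
open Literature.NumberTheory.Weil1964 Literature.RepresentationTheory.HeisenbergGroup
open Summit.HodgeConjecture.HodgeConjecture.Cruxes.HLiu418.K2LiuUndoublingSeesawPermutation
open Summit.HodgeConjecture.HodgeConjecture.Cruxes.HLiu418.K2LiuUndoublingSeesawPermutationMem

namespace Summit.HodgeConjecture.HodgeConjecture.Cruxes.HLiu418.K2LiuUndoublingSeesawPermutationSymplectic

/-! ## §1 Coordinates: the see-saw permutation re-labels pure tensors -/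

section Coordinates

variable (F : Type) [Field F] [NumberField F]
variable {N nV : ℕ} (e₁ : Fin (N + N) × Fin 1 ≃ Fin nV) (e₀ : Fin N × Fin 1 ≃ Fin N)

omit [Field F] [NumberField F] in
/-- `ρ⁻¹ (σ⁻¹ z) = e₂ ((r ⊕ r) z)`: the inverse see-saw permutation after `σ⁻¹` is the doubled enumeration of the row relabelling.
[cite: Kudla1984, §1] -/
theorem seesawPerm_symm_idxSplitD_symm (z : Fin (N + N) ⊕ Fin (N + N)) :
    (seesawPerm e₁ e₀).symm ((idxSplitD e₁ e₀ e₀).symm z) =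
      finSumFinEquiv (m := nV) (n := nV) (Sum.map (rowEquiv e₁) (rowEquiv e₁) z) := by
  apply (seesawPerm e₁ e₀).injective
  apply (idxSplitD e₁ e₀ e₀).injective
  rw [Equiv.apply_symm_apply, Equiv.apply_symm_apply, idxSplitD_seesawPerm_finSumFinEquiv, Sum.map_map,
    Equiv.symm_comp_self, Sum.map_id_id, id]

/-- **re-labelling**: `R_ρ (Ψ₁ ⊠_{ρ ≫ e} Ψ₂) = Ψ₁ ⊠_e Ψ₂` for any permutation `ρ` and splitting `e`. [cite: Weil1964, Chap. I n° 13 p. 160] -/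
theorem piSBReindex_sumTensor_trans {κ κ₁ κ₂ : Type} [Fintype κ] [Fintype κ₁] [Fintype κ₂] (ρ : κ ≃ κ) (e : κ ≃ κ₁ ⊕ κ₂)
    (Ψ₁ : piSchwartzBruhat F κ₁) (Ψ₂ : piSchwartzBruhat F κ₂) :
    piSBReindex F ρ (sumTensor F (ρ.trans e) Ψ₁ Ψ₂) = sumTensor F e Ψ₁ Ψ₂ := by
  apply Subtype.ext
  funext w
  simp only [coe_piSBReindex_apply, coe_sumTensor_apply, Equiv.symm_trans_apply, Function.comp_apply, Equiv.apply_symm_apply]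

/-- **the shuffle**: `Ψ₁ ⊠_{ρ ≫ σ} Ψ₂ = R_{e₂} (R_r Ψ₁ ⊠ R_r Ψ₂)` — a pure tensor along the see-saw splitting `σ = idxSplitD e₁ e₀ e₀` precomposed with
`ρ` IS a doubled pure tensor along `e₂` of the two row-relabelled factors (`r = rowEquiv e₁`). [cite: Kudla1984, §1] [cite: Kudla1994, §2 (doubled space, Siegel parabolic)] -/
theorem sumTensor_seesawPerm_trans_idxSplitD (Ψ₁ Ψ₂ : piSchwartzBruhat F (Fin (N + N))) :
    sumTensor F ((seesawPerm e₁ e₀).trans (idxSplitD e₁ e₀ e₀)) Ψ₁ Ψ₂ =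
      (piSBReindex F (finSumFinEquiv (m := nV) (n := nV)).symm).symm
        (tensorToSum F (Fin nV) (Fin nV) (piSBReindex F (rowEquiv e₁) Ψ₁) (piSBReindex F (rowEquiv e₁) Ψ₂)) := by
  apply Subtype.ext
  funext w
  simp only [coe_sumTensor_apply, coe_piSBReindex_symm_apply, coe_piSBReindex_apply, Equiv.symm_symm, coe_tensorToSum,
    boxTensor_apply, Function.comp_def, Equiv.symm_trans_apply, seesawPerm_symm_idxSplitD_symm, Sum.map_inl, Sum.map_inr]

end Coordinates

/-! ## §2 Matrices: the permutation commutes with `T^𝔻_𝔸`; its CM real ∕ imaginary parts -/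

section Matrices

variable (L : Type) [Field L] [NumberField L] [IsCMField L]
variable {N nV : ℕ} (e₁ : Fin (N + N) × Fin 1 ≃ Fin nV) (e₀ : Fin N × Fin 1 ≃ Fin N) (he₀ : ∀ m, (e₀.symm m).1 = m)
  (dV : Fin (N + N) → L) (hdV : ∀ i, IsCMField.complexConj L (dV i) = dV i) (hdV0 : ∀ i, dV i ≠ 0)
  (hV : ∀ i, dV (Fin.natAdd N i) = -dV (Fin.castAdd N i))
  (dW : Fin 1 → L) (hdW : ∀ i, IsCMField.complexConj L (dW i) = dW i) (hdW0 : ∀ i, dW i ≠ 0)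

include he₀ hV in
/-- `T^𝔻_𝔸.submatrix ρ ρ = T^𝔻_𝔸`. [cite: HarrisKudlaSweet1996, §1 (1.9)] [cite: Kudla1984, §1] -/
theorem gramDA_submatrix_seesawPerm :
    (gramDA L e₁ dV hdV dW hdW).submatrix (seesawPerm e₁ e₀) (seesawPerm e₁ e₀) = gramDA L e₁ dV hdV dW hdW := by
  rw [gramDA, Matrix.submatrix_map, gramD_submatrix_seesawPerm L e₁ e₀ he₀ dV hdV hV dW hdW]

include he₀ hV in
/-- **the permutation matrix commutes with `T^𝔻_𝔸`**: `P · T^𝔻_𝔸 = T^𝔻_𝔸 · P`. [cite: Kudla1984, §1] -/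
theorem permGL_mul_gramDA :
    ((K2LiuUndoublingSeesawPermutation.permGL (seesawPerm e₁ e₀) : GL (Fin (nV + nV)) (AdeleRing (𝓞 (Fp L)) (Fp L))) :
        Matrix (Fin (nV + nV)) (Fin (nV + nV)) (AdeleRing (𝓞 (Fp L)) (Fp L))) * gramDA L e₁ dV hdV dW hdW =
      gramDA L e₁ dV hdV dW hdW *
        ((K2LiuUndoublingSeesawPermutation.permGL (seesawPerm e₁ e₀) : GL (Fin (nV + nV)) (AdeleRing (𝓞 (Fp L)) (Fp L))) :
          Matrix (Fin (nV + nV)) (Fin (nV + nV)) (AdeleRing (𝓞 (Fp L)) (Fp L))) := by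
  have h := permGL_inv_mul_mul (R := AdeleRing (𝓞 (Fp L)) (Fp L)) (seesawPerm e₁ e₀) (gramDA L e₁ dV hdV dW hdW)
  rw [gramDA_submatrix_seesawPerm L e₁ e₀ he₀ dV hdV hV dW hdW] at h
  have h2 := congrArg
    (fun M => ((K2LiuUndoublingSeesawPermutation.permGL (seesawPerm e₁ e₀) : GL (Fin (nV + nV)) (AdeleRing (𝓞 (Fp L)) (Fp L))) :
      Matrix (Fin (nV + nV)) (Fin (nV + nV)) (AdeleRing (𝓞 (Fp L)) (Fp L))) * M) h
  simp only [← Matrix.mul_assoc, Units.mul_inv, Matrix.one_mul] at h2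
  exact h2.symm

include he₀ hV hdV0 hdW0 in
/-- **`T⁻¹ · ᵗ(P⁻¹) · T = P`** over `𝔸_{L⁺}` (`P` orthogonal and commuting with `T = T^𝔻_𝔸`): the contragredient half of Weil's Levi element `m(P)` is
`P` again. [cite: Weil1964, Chap. I n° 13 p. 160] [cite: Kudla1984, §1] -/
theorem gramDA_inv_mul_transpose_permGL_inv_mul_gramDA :
    (gramDA L e₁ dV hdV dW hdW)⁻¹ *
        ((((K2LiuUndoublingSeesawPermutation.permGL (seesawPerm e₁ e₀))⁻¹ : GL (Fin (nV + nV)) (AdeleRing (𝓞 (Fp L)) (Fp L))) :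
          Matrix (Fin (nV + nV)) (Fin (nV + nV)) (AdeleRing (𝓞 (Fp L)) (Fp L))))ᵀ * gramDA L e₁ dV hdV dW hdW =
      ((K2LiuUndoublingSeesawPermutation.permGL (seesawPerm e₁ e₀) : GL (Fin (nV + nV)) (AdeleRing (𝓞 (Fp L)) (Fp L))) :
        Matrix (Fin (nV + nV)) (Fin (nV + nV)) (AdeleRing (𝓞 (Fp L)) (Fp L))) := by
  have ht : ((((K2LiuUndoublingSeesawPermutation.permGL (seesawPerm e₁ e₀))⁻¹ : GL (Fin (nV + nV)) (AdeleRing (𝓞 (Fp L)) (Fp L))) :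
      Matrix (Fin (nV + nV)) (Fin (nV + nV)) (AdeleRing (𝓞 (Fp L)) (Fp L))))ᵀ =
      ((K2LiuUndoublingSeesawPermutation.permGL (seesawPerm e₁ e₀) : GL (Fin (nV + nV)) (AdeleRing (𝓞 (Fp L)) (Fp L))) :
        Matrix (Fin (nV + nV)) (Fin (nV + nV)) (AdeleRing (𝓞 (Fp L)) (Fp L))) := by
    rw [← transpose_coe_permGL, Matrix.transpose_transpose]
  rw [ht, Matrix.mul_assoc, permGL_mul_gramDA L e₁ e₀ he₀ dV hdV hV dW hdW, ← Matrix.mul_assoc,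
    Matrix.nonsing_inv_mul _ (isUnit_det_gramDA L e₁ dV hdV hdV0 dW hdW hdW0), Matrix.one_mul]

/-- the CM real part of the permutation matrix is the permutation matrix over `L⁺`. [cite: GelbartRogawski1991, §3.1 p. 455] -/
theorem map_re_coe_permGL {m : Type*} [Fintype m] [DecidableEq m] (ρ : m ≃ m) :
    ((K2LiuUndoublingSeesawPermutation.permGL ρ : GL m L) : Matrix m m L).map
        (UnitaryGroup.QuadraticCoordinates.re (UnitaryGroup.quadraticRatCoords L
          (UnitaryGroup.not_mem_range_algebraMap_of_apply_eq_neg L (IsCMField.complexConj L) (complexConj_imagUnit L)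
            (imagUnit_ne_zero L))).toAddEquiv) =
      ((K2LiuUndoublingSeesawPermutation.permGL ρ : GL m (Fp L)) : Matrix m m (Fp L)) := by
  have hq := UnitaryGroup.isQuadraticCoordinates_rat L (IsCMField.complexConj L) (complexConj_imagUnit L) (imagUnit_ne_zero L)
    (imagUnit_mul_self L)
  have hre0 := hq.re_map 0
  rw [map_zero] at hre0
  refine Matrix.ext fun i j => ?_
  rw [Matrix.map_apply, K2LiuUndoublingSeesawPermutation.coe_permGL, K2LiuUndoublingSeesawPermutation.coe_permGL,
    PEquiv.toMatrix_apply, PEquiv.toMatrix_apply]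
  split_ifs
  · exact hq.re_one
  · exact hre0

/-- the CM imaginary part of the permutation matrix vanishes. [cite: GelbartRogawski1991, §3.1 p. 455] -/
theorem map_im_coe_permGL {m : Type*} [Fintype m] [DecidableEq m] (ρ : m ≃ m) :
    ((K2LiuUndoublingSeesawPermutation.permGL ρ : GL m L) : Matrix m m L).map
        (UnitaryGroup.QuadraticCoordinates.im (UnitaryGroup.quadraticRatCoords L
          (UnitaryGroup.not_mem_range_algebraMap_of_apply_eq_neg L (IsCMField.complexConj L) (complexConj_imagUnit L)
            (imagUnit_ne_zero L))).toAddEquiv) =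
      0 := by
  have hq := UnitaryGroup.isQuadraticCoordinates_rat L (IsCMField.complexConj L) (complexConj_imagUnit L) (imagUnit_ne_zero L)
    (imagUnit_mul_self L)
  have him0 := hq.im_map 0
  rw [map_zero] at him0
  refine Matrix.ext fun i j => ?_
  rw [Matrix.map_apply, K2LiuUndoublingSeesawPermutation.coe_permGL, PEquiv.toMatrix_apply, Matrix.zero_apply]
  split_ifs
  · exact hq.im_one
  · exact him0

end Matrices

/-! ## §3 `ι^𝔻(δ′)` is the adelic image of Weil's rational Levi element `m(P)` -/

section Symplectic

variable (L : Type) [Field L] [NumberField L] [IsCMField L]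
variable {N nV : ℕ} (e₁ : Fin (N + N) × Fin 1 ≃ Fin nV) (e₀ : Fin N × Fin 1 ≃ Fin N) (he₀ : ∀ m, (e₀.symm m).1 = m)
  (dV : Fin (N + N) → L) (hdV : ∀ i, IsCMField.complexConj L (dV i) = dV i) (hdV0 : ∀ i, dV i ≠ 0)
  (hV : ∀ i, dV (Fin.natAdd N i) = -dV (Fin.castAdd N i))
  (dW : Fin 1 → L) (hdW : ∀ i, IsCMField.complexConj L (dW i) = dW i) (hdW0 : ∀ i, dW i ≠ 0)

include he₀ hV in
/-- **`ι^𝔻(δ′) = ratSp (m(P))`**: the symplectic image (restriction of scalars `L → L⁺` in the CM coordinates) of the rational unitary point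
`δ′ = permGL ρ ∈ H(V)(L⁺) ≤ H(V)(𝔸)` is the adelic image of Weil's rational Levi element `m(P) = diag(P, ᵗP⁻¹)` of `Sp_{2(n+n)}(L⁺)`,
`P = permGL ρ ∈ GL_{n+n}(L⁺)` — both act on `𝔸^{n+n} × 𝔸^{n+n}` by `(a, b) ↦ (P a, P b)` (real matrix, `T⁻¹ ᵗP⁻¹ T = P`).
[cite: GelbartRogawski1991, §3.1 p. 455] [cite: Weil1964, Chap. I n° 13 p. 160, Chap. III n° 37 p. 188] [cite: Kudla1994, §2 (doubled space, Siegel parabolic)] -/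
theorem toSpD_permGL_seesawPerm :
    toSpD L e₁ dV hdV dW hdW
        ⟨K2LiuUndoublingSeesawPermutation.permGL (seesawPerm e₁ e₀), permGL_seesawPerm_mem_HA L e₁ e₀ he₀ dV hdV hV dW hdW⟩ =
      ratSp (Fp L) (gramDA L e₁ dV hdV dW hdW) (isUnit_det_gramDA L e₁ dV hdV hdV0 dW hdW hdW0)
        (SymplecticMatrix.levi (K2LiuUndoublingSeesawPermutation.permGL (seesawPerm e₁ e₀) : GL (Fin (nV + nV)) (Fp L))) := by
  rw [← toAdelic_permGL_seesawPerm L e₁ e₀ he₀ dV hdV hV dW hdW, ratSp_levi]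
  apply Subtype.ext
  refine LinearEquiv.ext fun v => ?_
  obtain ⟨a, b⟩ := v
  have hrat : ratGL (Fp L) (K2LiuUndoublingSeesawPermutation.permGL (seesawPerm e₁ e₀) : GL (Fin (nV + nV)) (Fp L)) =
      (K2LiuUndoublingSeesawPermutation.permGL (seesawPerm e₁ e₀) : GL (Fin (nV + nV)) (AdeleRing (𝓞 (Fp L)) (Fp L))) :=
    map_permGL (seesawPerm e₁ e₀) (algebraMap (Fp L) (AdeleRing (𝓞 (Fp L)) (Fp L)))
  have hmapA : ((K2LiuUndoublingSeesawPermutation.permGL (seesawPerm e₁ e₀) : GL (Fin (nV + nV)) (Fp L)) :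
        Matrix (Fin (nV + nV)) (Fin (nV + nV)) (Fp L)).map (algebraMap (Fp L) (AdeleRing (𝓞 (Fp L)) (Fp L))) =
      ((K2LiuUndoublingSeesawPermutation.permGL (seesawPerm e₁ e₀) : GL (Fin (nV + nV)) (AdeleRing (𝓞 (Fp L)) (Fp L))) :
        Matrix (Fin (nV + nV)) (Fin (nV + nV)) (AdeleRing (𝓞 (Fp L)) (Fp L))) := by
    rw [K2LiuUndoublingSeesawPermutation.coe_permGL, K2LiuUndoublingSeesawPermutation.coe_permGL, toPEquiv_toMatrix_map]
  have key := UnitaryGroup.adelicToSymplectic_toAdelic_apply (Fp L) L (IsCMField.complexConj L) (nV + nV) (complexConj_imagUnit L)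
    (imagUnit_ne_zero L) (imagUnit_mul_self L) (gramD_isSymm L e₁ dV hdV dW hdW) (J := hermD L e₁ dV hdV dW hdW) rfl
    ⟨K2LiuUndoublingSeesawPermutation.permGL (seesawPerm e₁ e₀), permGL_seesawPerm_mem_rational L e₁ e₀ he₀ dV hdV hV dW hdW⟩ a b
  refine key.trans ?_
  have hval : ((⟨K2LiuUndoublingSeesawPermutation.permGL (seesawPerm e₁ e₀), permGL_seesawPerm_mem_rational L e₁ e₀ he₀ dV hdV hV dW hdW⟩ :
      ↥(UnitaryGroup.rational (Fp L) L (IsCMField.complexConj L) (nV + nV) (hermD L e₁ dV hdV dW hdW))) : GL (Fin (nV + nV)) L) =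
      K2LiuUndoublingSeesawPermutation.permGL (seesawPerm e₁ e₀) := rfl
  rw [coe_leviSp_apply, SymplecticMatrix.glEquiv_apply, SymplecticMatrix.leviDual_apply, hrat,
    gramDA_inv_mul_transpose_permGL_inv_mul_gramDA L e₁ e₀ he₀ dV hdV hdV0 hV dW hdW hdW0, hval, map_re_coe_permGL, map_im_coe_permGL,
    hmapA, Matrix.map_zero _ (map_zero _), Matrix.zero_mulVec, Matrix.zero_mulVec, smul_zero, add_zero, zero_add]

end Symplectic

/-! ## §4 Every lift of `ι^𝔻(δ′)` acts on `𝒮(𝔸^{n+n})` by `R_ρ` up to a central scalar -/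

section Lift

variable (L : Type) [Field L] [NumberField L] [IsCMField L]
variable {N nV : ℕ} (e₁ : Fin (N + N) × Fin 1 ≃ Fin nV) (e₀ : Fin N × Fin 1 ≃ Fin N) (he₀ : ∀ m, (e₀.symm m).1 = m)
  (dV : Fin (N + N) → L) (hdV : ∀ i, IsCMField.complexConj L (dV i) = dV i) (hdV0 : ∀ i, dV i ≠ 0)
  (hV : ∀ i, dV (Fin.natAdd N i) = -dV (Fin.castAdd N i))
  (dW : Fin 1 → L) (hdW : ∀ i, IsCMField.complexConj L (dW i) = dW i) (hdW0 : ∀ i, dW i ≠ 0)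

include hdV0 hdW0 in
/-- **Weil's rational lift of `m(P)` acts by `R_ρ`** on `𝒮(𝔸^{n+n})`: `ω(r_F^𝔻(m(P))) Ψ = R_ρ Ψ`, `(R_ρ Ψ)(w) = Ψ(w ∘ ρ)` — character factor `1`
(★ `coe_omega_ratThetaLiftCont_levi_perm` at `σ := ρ⁻¹`, `P = P_{ρ⁻¹}`). [cite: Weil1964, Chap. I n° 13 p. 160 and Chap. III n° 41 Thm 6 p. 193] -/
theorem omega_rFD_levi_permGL (Ψ : piSchwartzBruhat (Fp L) (Fin (nV + nV))) :
    adelicMpCont.omega (Fp L) (Fin (nV + nV)) (gramDA L e₁ dV hdV dW hdW)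
        (rFD L e₁ dV hdV hdV0 dW hdW hdW0
          (SymplecticMatrix.levi (K2LiuUndoublingSeesawPermutation.permGL (seesawPerm e₁ e₀) : GL (Fin (nV + nV)) (Fp L)))) Ψ =
      piSBReindex (Fp L) (seesawPerm e₁ e₀) Ψ := by
  have hγ : ((K2LiuUndoublingSeesawPermutation.permGL (seesawPerm e₁ e₀) : GL (Fin (nV + nV)) (Fp L)) :
      Matrix (Fin (nV + nV)) (Fin (nV + nV)) (Fp L)) = Equiv.Perm.permMatrix (Fp L) (seesawPerm e₁ e₀).symm := rfl
  have h := coe_omega_ratThetaLiftCont_levi_perm (Fp L) (gramDA L e₁ dV hdV dW hdW) (isUnit_det_gramDA L e₁ dV hdV hdV0 dW hdW hdW0)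
    (K2LiuUndoublingSeesawPermutation.permGL (seesawPerm e₁ e₀)) (seesawPerm e₁ e₀).symm hγ Ψ
  apply Subtype.ext
  refine h.trans ?_
  funext x
  rw [coe_piSBReindex_apply, Equiv.symm_symm]
  rfl

include he₀ hV hdV0 hdW0 in
/-- **every lift of `ι^𝔻(δ′)` acts by `R_ρ` up to a scalar**: for `sD : H(𝔸) →* Mp(𝕎^𝔻)ᶜᵒⁿᵗ` over `ι^𝔻`, there is `c ≠ 0` with
`ω(sD δ′) Ψ = c • R_ρ Ψ` for all `Ψ` (`sD δ′ = r_F(m(P)) · (1, c)` by exactness of `1 → ℂˣ → Mp → Sp` at `ι^𝔻(δ′) = ratSp (m(P))`).  On road (N″)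
the scalar cancels: only conjugation by `sD δ′` is used. [cite: GelbartRogawski1991, §3.1 p. 454 L21–33] [cite: Weil1964, Chap. III n° 37 p. 188 and n° 41 Thm 6 p. 193]
[cite: Kudla1994, §2 (doubled space, Siegel parabolic)] -/
theorem exists_omega_eq_smul_piSBReindex {sD : HA L e₁ dV hdV dW hdW →* MpD L e₁ dV hdV dW hdW}
    (hproj : ∀ h, projD L e₁ dV hdV dW hdW (sD h) = toSpD L e₁ dV hdV dW hdW h) :
    ∃ c : ℂ, c ≠ 0 ∧ ∀ Ψ : piSchwartzBruhat (Fp L) (Fin (nV + nV)),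
      adelicMpCont.omega (Fp L) (Fin (nV + nV)) (gramDA L e₁ dV hdV dW hdW)
          (sD ⟨K2LiuUndoublingSeesawPermutation.permGL (seesawPerm e₁ e₀), permGL_seesawPerm_mem_HA L e₁ e₀ he₀ dV hdV hV dW hdW⟩) Ψ =
        c • piSBReindex (Fp L) (seesawPerm e₁ e₀) Ψ := by
  -- the two elements over `ι^𝔻(δ′)`
  have hq : projD L e₁ dV hdV dW hdW
      (sD ⟨K2LiuUndoublingSeesawPermutation.permGL (seesawPerm e₁ e₀), permGL_seesawPerm_mem_HA L e₁ e₀ he₀ dV hdV hV dW hdW⟩) =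
      projD L e₁ dV hdV dW hdW (rFD L e₁ dV hdV hdV0 dW hdW hdW0
        (SymplecticMatrix.levi (K2LiuUndoublingSeesawPermutation.permGL (seesawPerm e₁ e₀) : GL (Fin (nV + nV)) (Fp L)))) := by
    exact (hproj _).trans ((toSpD_permGL_seesawPerm L e₁ e₀ he₀ dV hdV hdV0 hV dW hdW hdW0).trans
      (proj_ratThetaLiftCont (Fp L) (gramDA L e₁ dV hdV dW hdW) (isUnit_det_gramDA L e₁ dV hdV hdV0 dW hdW hdW0) _).symm)
  -- exactness: `r⁻¹ · sD δ′ = (1, t)`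
  have h1 : projD L e₁ dV hdV dW hdW
      ((rFD L e₁ dV hdV hdV0 dW hdW hdW0
          (SymplecticMatrix.levi (K2LiuUndoublingSeesawPermutation.permGL (seesawPerm e₁ e₀) : GL (Fin (nV + nV)) (Fp L))))⁻¹ *
        sD ⟨K2LiuUndoublingSeesawPermutation.permGL (seesawPerm e₁ e₀), permGL_seesawPerm_mem_HA L e₁ e₀ he₀ dV hdV hV dW hdW⟩) = 1 :=
    -- (term-mode chain: `rw [map_inv]` over these carriers is the isDefEq cliff)
    (map_mul (projD L e₁ dV hdV dW hdW) _ _).trans <|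
      (congrArg (· * projD L e₁ dV hdV dW hdW
          (sD ⟨K2LiuUndoublingSeesawPermutation.permGL (seesawPerm e₁ e₀), permGL_seesawPerm_mem_HA L e₁ e₀ he₀ dV hdV hV dW hdW⟩))
        (map_inv (projD L e₁ dV hdV dW hdW) _)).trans <|
        (congrArg (fun z => z⁻¹ * projD L e₁ dV hdV dW hdW
          (sD ⟨K2LiuUndoublingSeesawPermutation.permGL (seesawPerm e₁ e₀), permGL_seesawPerm_mem_HA L e₁ e₀ he₀ dV hdV hV dW hdW⟩))
          hq.symm).trans <| inv_mul_cancel _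
  -- (`Exists.elim` rather than `obtain`: `rcases` bookkeeping on these carriers exhausts the default budget)
  refine (adelicMpCont.exists_eq_ofScalar_of_proj_eq_one
    ((Matrix.isUnit_iff_isUnit_det _).mpr (isUnit_det_gramDA L e₁ dV hdV hdV0 dW hdW hdW0))
    ((rFD L e₁ dV hdV hdV0 dW hdW hdW0
          (SymplecticMatrix.levi (K2LiuUndoublingSeesawPermutation.permGL (seesawPerm e₁ e₀) : GL (Fin (nV + nV)) (Fp L))))⁻¹ *
        sD ⟨K2LiuUndoublingSeesawPermutation.permGL (seesawPerm e₁ e₀), permGL_seesawPerm_mem_HA L e₁ e₀ he₀ dV hdV hV dW hdW⟩)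
    h1).elim fun t ht => ?_
  have ht' : sD ⟨K2LiuUndoublingSeesawPermutation.permGL (seesawPerm e₁ e₀), permGL_seesawPerm_mem_HA L e₁ e₀ he₀ dV hdV hV dW hdW⟩ =
      rFD L e₁ dV hdV hdV0 dW hdW hdW0
          (SymplecticMatrix.levi (K2LiuUndoublingSeesawPermutation.permGL (seesawPerm e₁ e₀) : GL (Fin (nV + nV)) (Fp L))) *
        adelicMpCont.ofScalar (Fp L) (Fin (nV + nV)) (gramDA L e₁ dV hdV dW hdW) t :=
    (mul_inv_cancel_left _ _).symm.trans (congrArg (HMul.hMul (rFD L e₁ dV hdV hdV0 dW hdW hdW0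
      (SymplecticMatrix.levi (K2LiuUndoublingSeesawPermutation.permGL (seesawPerm e₁ e₀) : GL (Fin (nV + nV)) (Fp L))))) ht)
  refine ⟨(t : ℂ), t.ne_zero, ?_⟩
  intro Ψ
  -- `ω(sD δ′) Ψ = ω(r) (ω(1,t) Ψ) = ω(r) (t • Ψ) = t • ω(r) Ψ = t • R_ρ Ψ` (explicit chain, no `rw` across the carriers)
  have hm := LinearMap.congr_fun (map_mul (adelicMpCont.omega (Fp L) (Fin (nV + nV)) (gramDA L e₁ dV hdV dW hdW))
    (rFD L e₁ dV hdV hdV0 dW hdW hdW0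
      (SymplecticMatrix.levi (K2LiuUndoublingSeesawPermutation.permGL (seesawPerm e₁ e₀) : GL (Fin (nV + nV)) (Fp L))))
    (adelicMpCont.ofScalar (Fp L) (Fin (nV + nV)) (gramDA L e₁ dV hdV dW hdW) t)) Ψ
  refine (congrArg (fun m => adelicMpCont.omega (Fp L) (Fin (nV + nV)) (gramDA L e₁ dV hdV dW hdW) m Ψ) ht').trans (hm.trans ?_)
  refine ((adelicMpCont.omega (Fp L) (Fin (nV + nV)) (gramDA L e₁ dV hdV dW hdW)
    (rFD L e₁ dV hdV hdV0 dW hdW hdW0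
      (SymplecticMatrix.levi (K2LiuUndoublingSeesawPermutation.permGL (seesawPerm e₁ e₀) : GL (Fin (nV + nV)) (Fp L))))).map_smul
    (t : ℂ) Ψ).trans ?_
  rw [omega_rFD_levi_permGL L e₁ e₀ dV hdV hdV0 dW hdW hdW0]

end Lift

end Summit.HodgeConjecture.HodgeConjecture.Cruxes.HLiu418.K2LiuUndoublingSeesawPermutationSymplectic

end
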